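import Summits.BirchSwinnertonDyer.BirchSwinnertonDyer.Theorems.EisensteinPrimesGoodLatticeBDPValueOfNamedFactsALG
import Summits.BirchSwinnertonDyer.BirchSwinnertonDyer.Theses.EisensteinPrimes
import Summits.BirchSwinnertonDyer.BirchSwinnertonDyer.Theorems.EisensteinPrimesGoodLatticeBDPValueOfFacts
import Summits.BirchSwinnertonDyer.BirchSwinnertonDyer.Theorems.EisensteinPrimesGoodLatticeBDPValueOfOneInequality
import Summits.BirchSwinnertonDyer.BirchSwinnertonDyer.Theorems.EisensteinPrimesGoodLatticeBDPValueOfLambdaIdentity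
import Summits.BirchSwinnertonDyer.BirchSwinnertonDyer.Theorems.EisensteinPrimesGoodLatticeBDPValueOfLambdaIdentityAnQ
import Summits.BirchSwinnertonDyer.BirchSwinnertonDyer.Theorems.EisensteinPrimesGoodLatticeBDPValueOfLambdaInequalityAnQ
import Summits.BirchSwinnertonDyer.BirchSwinnertonDyer.Theorems.EisensteinPrimesGoodLatticeBDPValueFullDescentStub
import HarnessLib
/-!
# Crux 2 `GoodLatticeBDPValue` (stmt-BirchSwinnertonDyer-19032) MODULO ITS NAMED FACTS — part 2/2 ([AN] glue and the composition)

LEAD bsd-line-x1-p1 (gen 5), cell `bsd-eis`. The registered line `halves` (skeleton v22, `Cruxes/GoodLatticeBDPValue/Lines/halves.lean`,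
sha256 873a80a3…) has NO KERNEL STUB left: its five `sorry`s are NAMED-FACT bundles (20 PUBLISHED facts by name) and the
PUB-composed candidate 3a-A. These two files (`…OfNamedFactsALG`, `…OfNamedFacts`) are that skeleton with every stub turned into
an explicit HYPOTHESIS (section `variable`s, `include`d where used) — i.e. the sorry-free, gate-checked form of the statement
«crux 2 holds modulo exactly these named facts»: the last theorem of part 2,
`GoodLatticeBDPValueOfNamedFacts.goodLatticeBDPValue_of_namedFacts`, has type
`⟨stub 1: 7 PUB⟩ → ⟨3a-A⟩ → ⟨stub 4: 8 PUB⟩ → ⟨stub 4b: 4 PUB⟩ → ⟨CD2⟩ → Summit.….Theses.EisensteinPrimes.GoodLatticeBDPValue`.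
This part carries the [AN] glue (`thm222_OPEN_of_slices`, the 3a join `anThreeTrivial_of_split` over the LANDED 3a-B
`GoodLatticeBDPValueFullDescentStub.stub_fullDescentAtThreeOfRed`, `anQ_of_pieces`) and the final composition
`goodLatticeBDPValue_of_namedFacts` (via p650549 `GoodLatticeBDPValueOfLambdaInequalityAnQ.goodLatticeBDPValue_of_pub_of_leTD_of_le_of_anQ`),
verbatim from the skeleton with the stubs as hypotheses. HONEST FRAMING: CONDITIONAL theorems (hypotheses = published results
as `Prop`s + 3a-A); no named fact is discharged, no summit statement / BSD / IMC / Keller–Yin theorem is proved; 0 sorry.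
[cite: KellerYin2024, Thm. 2.2.2, Thm. 3.0.8] [cite: CastellaGrossiLeeSkinner2022, Thm. 2.2.2 with (2.16), Thm. 5.1.3] [cite: Kriz2016, Thm. 34, Thm. 35, Rem. 33]
-/


-- `Summit.BirchSwinnertonDyer.BirchSwinnertonDyer.…`: the summit and its single sub-problem share a name (D-0017 layout).
set_option linter.dupNamespace false
set_option autoImplicit false
open scoped Classical

open PowerSeries WeierstrassCurve NumberField IsDedekindDomain Field
  Literature.NumberTheory.GaloisRepresentations Literature.NumberTheory.EllipticCurves.GreenbergVatsal2000
  Summit.BirchSwinnertonDyer.BirchSwinnertonDyer.Theorems.EisensteinPrimesMuLambda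
  Literature.NumberTheory.EllipticCurves Literature.NumberTheory.EllipticCurves.ModularForms
  Literature.NumberTheory.EllipticCurves.Rank1Residual Literature.NumberTheory.EllipticCurves.Castella2018
  Literature.NumberTheory.EllipticCurves.GreenbergSelmer Literature.NumberTheory.QuadraticFields
  Literature.NumberTheory.EllipticCurves.CastellaGrossiLeeSkinner2022
  Literature.NumberTheory.EllipticCurves.KellerYin2024 Literature.NumberTheory.EllipticCurves.IwasawaAlgebra
  Literature.NumberTheory.EllipticCurves.Rubin1991 Literature.NumberTheory.EllipticCurves.DeShalit1987
  Literature.NumberTheory.EllipticCurves.Hida2010MuInvariant Literature.NumberTheory.EllipticCurves.BCGKPST2020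
open Literature.NumberTheory.IwasawaTheory Literature.NumberTheory.IwasawaTheory.Greenberg2016
  Literature.NumberTheory.IwasawaTheory.Greenberg2006
open Summit.BirchSwinnertonDyer.Rank1Residual.X1.KellerYinHalves
  Summit.BirchSwinnertonDyer.Rank1Residual.X2.ResidualDevissageModules
  Summit.BirchSwinnertonDyer.Rank1Residual.X1.KellerYinMuLambdaSplitDSFree
  Summit.BirchSwinnertonDyer.BirchSwinnertonDyer.Theorems
  Summit.BirchSwinnertonDyer.BirchSwinnertonDyer.Theorems.GoodLatticeBDPValueHalves
  Summit.BirchSwinnertonDyer.BirchSwinnertonDyer.Theorems.GoodLatticeBDPValueOfImprimitive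
  Summit.BirchSwinnertonDyer.BirchSwinnertonDyer.Theorems.GoodLatticeBDPValueOfOneInequality
  Summit.BirchSwinnertonDyer.BirchSwinnertonDyer.Theorems.GoodLatticeImprimitiveOfQuotient
  Summit.BirchSwinnertonDyer.BirchSwinnertonDyer.Theorems.GoodLatticeQuotientOfCorank
  Summit.BirchSwinnertonDyer.BirchSwinnertonDyer.Theorems.GoodLatticeCorankOfGe

namespace Summit.BirchSwinnertonDyer.BirchSwinnertonDyer.Theorems.GoodLatticeBDPValueOfNamedFacts

section

variable (stub_publishedFacts :
    castellaHsieh2018_exists_isBDPLFunction ∧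
      (∀ (N : ℕ) [NeZero N], IsNewformOf.level_eq_conductorNorm (N := N)) ∧
      proofThm422_exists_isBDPLFunction_isTorsion_charIdeal_dvd ∧
      thm513_exists_isBDPLFunction_valueAtOne ∧
      thm331_rubin_exists_katzMeasure₂_pseudoIso_span_eq ∧
      thmII64_katzMeasure₂_functionalEquation ∧
      thmI_mu_katzBranch_reflect_eq_zero)
  (stub_anacongOfFullDescentDatum :
  ∀ (W : WeierstrassCurve ℚ) [W.IsElliptic] [W.IsGloballyMinimal] (p : ℕ) [Fact p.Prime],
    2 < p → Good W p → Red W p → Anom W p →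
    ((∃ (ℓ : ℕ) (hℓ : ℓ.Prime), haveI : Fact ℓ.Prime := ⟨hℓ⟩; Addv W ℓ) ∨
      (∃ (ℓ : ℕ) (hℓ : ℓ.Prime), haveI : Fact ℓ.Prime := ⟨hℓ⟩;
        W.HasMultiplicativeReductionAtPrime ℓ ∧
          ((W.HasSplitMultiplicativeReductionAtPrime ℓ ∧ ℓ ≡ 1 [MOD p]) ∨
            (¬ W.HasSplitMultiplicativeReductionAtPrime ℓ ∧ ℓ + 1 ≡ 0 [MOD p])))) →
    (∀ Φ : AddSubgroup (geomTorsion W (p : ℤ)), IsRationalLine W p Φ → ¬ LineUnramifiedAt W p Φ) →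
    ∀ (K : Type) [Field K] [NumberField K], IsImaginaryQuadratic K →
      SatisfiesHeegnerHypothesis (W.conductorNorm ℤ) K → SatisfiesHeegnerHypothesis p K →
      Odd (NumberField.discr K) → NumberField.discr K ≠ -3 →
      (∀ Q : (W.baseChange K).toAffine.Point, p • Q = 0 → Q = 0) →
    ∀ (ι : K →+* ℚ_[p]) (v vbar : HeightOneSpectrum (𝓞 K)),
      (∀ x : 𝓞 K, x ∈ v.asIdeal ↔ ‖ι (x : K)‖ < 1) →
      ((p : ℕ) : 𝓞 K) ∈ vbar.asIdeal → vbar ≠ v →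
    ∀ (κ : ZpExtension K p), κ.IsAnticyclotomic →
    ∀ (γ : absoluteGaloisGroup K) [Fact (κ.IsTopGenerator γ)],
    ∀ (N : ℕ) [NeZero N] (Dt : ModularParametrizationData W N),
    ∀ (ι' : PadicAlgCl p ≃+* ℂ),
      (∀ (w : InfinitePlace K) (k : 𝓞 K), k ∈ v.asIdeal ↔ ‖ι'.symm (w.embedding (k : K))‖ < 1) →
    ∀ (ΩK : ℂ) (Ωp : (unrIntegers p)ˣ) (L : UnrSeries p), ΩK ≠ 0 →
      IsBDPLFunction ι' v κ γ Dt.f ΩK ((Ωp : unrIntegers p) : ℂ_[p]) L →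
    ∀ (θsub θquot : FramedGaloisRep K (padicCoeffIntegers (∅ : Set (PadicAlgCl p))) 1),
      IsResidualPairOver (W.baseChange K) p θsub θquot →
    ∀ (Sf : Finset (HeightOneSpectrum (𝓞 K))),
      (∀ w : HeightOneSpectrum (𝓞 K), w ∈ Sf ↔ ((W.conductorNorm ℤ : ℤ) : 𝓞 K) ∈ w.asIdeal) →
    ∀ (θK : HeckeCharacter K), IsHeckeCharOf ι' θquot θK →
    ∀ (Cbar : Finset (HeightOneSpectrum (𝓞 K))), (∀ u ∈ Cbar, ¬ θK.IsUnramifiedAt u) →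
    ∀ (ΩK' : ℂ) (Ωp' : (unrIntegers p)ˣ) (Lφ : UnrSeries p), ΩK' ≠ 0 →
      IsKatzLFunction ι' v vbar Cbar κ γ θK ΩK' ((Ωp' : unrIntegers p) : ℂ_[p]) Lφ →
    ∃ n nφ : ℕ, FirstUnitCoeffAt L n ∧ FirstUnitCoeffAt Lφ nφ ∧
      n + ∑ w ∈ Sf, curveLocalLambda κ (W.baseChange K) w =
        2 * nφ + ∑ w ∈ Sf, (charLocalLambda ∅ κ θsub w + charLocalLambda ∅ κ θquot w))
  (stub_publishedFactsGreenberg :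
    prop411_selmer_isAlmostDivisible ∧ prop422_localCohomology_isAlmostDivisible ∧
      sec5A_localH2_subsingleton_of_LOC1 ∧ prop41_globalEulerPoincareCorank ∧
      prop42_localEulerPoincareCorank ∧ prop32_cohomology_isCofinitelyGenerated ∧
      BCGKPST2020.sec33_rubin_unrSelmer₂_finite_torsion ∧
      weakLeopoldt_H2_subsingleton_above_cyclotomic_of_isOpen)
  (stub_publishedFactsMore :
    prop263_sur_of_crk ∧ thm222_anacong_goodLattice_of_five_le ∧ thm222_anacong_goodLattice_of_ne_one ∧
      thm212_exists_isKatzLFunction)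
  (stub_publishedFactCD2 :
    ∀ (L : Type) [Field L] [NumberField L],
      Literature.NumberTheory.GaloisCohomology.groupCdLE_two_galoisGroupUnramifiedOutside L)

/-- **[AN] in the CGLS currency at every odd `p` from its three slices** (`5 ≤ p` PUB-composed, `𝟙̃|_{G_K} ≠ 𝟙`
PUB, `p = 3 ∧ 𝟙̃|_{G_K} = 𝟙` = stub 3a); pure logic. [cite: KellerYin2024, Thm. 2.2.2 (arXiv:2402.12781v2 TeX L1445–1448)]
[cite: CastellaGrossiLeeSkinner2022, Thm. 2.2.2 with (2.16)] [cite: Kriz2016, Rem. 33] -/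
theorem thm222_OPEN_of_slices (h5 : thm222_anacong_goodLattice_of_five_le)
    (hne : thm222_anacong_goodLattice_of_ne_one)
    (h3 :
  ∀ (W : WeierstrassCurve ℚ) [W.IsElliptic] [W.IsGloballyMinimal] (p : ℕ) [Fact p.Prime],
        p = 3 → Good W p → Red W p → Anom W p →
        (∀ Φ : AddSubgroup (geomTorsion W (p : ℤ)), IsRationalLine W p Φ → ¬ LineUnramifiedAt W p Φ) →
        ∀ (K : Type) [Field K] [NumberField K], IsImaginaryQuadratic K →
          SatisfiesHeegnerHypothesis (W.conductorNorm ℤ) K → SatisfiesHeegnerHypothesis p K →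
          Odd (NumberField.discr K) → NumberField.discr K ≠ -3 →
          (∀ Q : (W.baseChange K).toAffine.Point, p • Q = 0 → Q = 0) →
        ∀ (ι : K →+* ℚ_[p]) (v vbar : HeightOneSpectrum (𝓞 K)),
          (∀ x : 𝓞 K, x ∈ v.asIdeal ↔ ‖ι (x : K)‖ < 1) →
          ((p : ℕ) : 𝓞 K) ∈ vbar.asIdeal → vbar ≠ v →
        ∀ (κ : ZpExtension K p), κ.IsAnticyclotomic →
        ∀ (γ : absoluteGaloisGroup K) [Fact (κ.IsTopGenerator γ)],
        ∀ (N : ℕ) [NeZero N] (Dt : ModularParametrizationData W N),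
        ∀ (ι' : PadicAlgCl p ≃+* ℂ),
          (∀ (w : InfinitePlace K) (k : 𝓞 K), k ∈ v.asIdeal ↔ ‖ι'.symm (w.embedding (k : K))‖ < 1) →
        ∀ (ΩK : ℂ) (Ωp : (unrIntegers p)ˣ) (L : UnrSeries p), ΩK ≠ 0 →
          IsBDPLFunction ι' v κ γ Dt.f ΩK ((Ωp : unrIntegers p) : ℂ_[p]) L →
        ∀ (θsub θquot : FramedGaloisRep K (padicCoeffIntegers (∅ : Set (PadicAlgCl p))) 1),
          IsResidualPairOver (W.baseChange K) p θsub θquot → (∀ σ : absoluteGaloisGroup K, θquot σ = 1) →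
        ∀ (Sf : Finset (HeightOneSpectrum (𝓞 K))),
          (∀ w : HeightOneSpectrum (𝓞 K), w ∈ Sf ↔ ((W.conductorNorm ℤ : ℤ) : 𝓞 K) ∈ w.asIdeal) →
        ∀ (θK : HeckeCharacter K), IsHeckeCharOf ι' θquot θK →
        ∀ (Cbar : Finset (HeightOneSpectrum (𝓞 K))), (∀ u ∈ Cbar, ¬ θK.IsUnramifiedAt u) →
        ∀ (ΩK' : ℂ) (Ωp' : (unrIntegers p)ˣ) (Lφ : UnrSeries p), ΩK' ≠ 0 →
          IsKatzLFunction ι' v vbar Cbar κ γ θK ΩK' ((Ωp' : unrIntegers p) : ℂ_[p]) Lφ →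
        ∃ n nφ : ℕ, FirstUnitCoeffAt L n ∧ FirstUnitCoeffAt Lφ nφ ∧
          n + ∑ w ∈ Sf, curveLocalLambda κ (W.baseChange K) w =
            2 * nφ + ∑ w ∈ Sf, (charLocalLambda ∅ κ θsub w + charLocalLambda ∅ κ θquot w)) :
    thm222_anacong_goodLattice_OPEN := by
  intro W _ _ p _ hp hgood hred hanom hlat K _ _ hK hH hHp hodd hd3 htor ι v vbar hv hvbar hvne κ hκ γ _
    N _ Dt ι' hι' ΩK Ωp L hΩ hL θsub θquot hpair Sf hSf θK hθK Cbar hC ΩK' Ωp' Lφ hΩ' hLφ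
  by_cases h5le : 5 ≤ p
  · exact h5 W p h5le hgood hred hanom hlat K hK hH hHp hodd hd3 htor ι v vbar hv hvbar hvne κ hκ γ N Dt
      ι' hι' ΩK Ωp L hΩ hL θsub θquot hpair Sf hSf θK hθK Cbar hC ΩK' Ωp' Lφ hΩ' hLφ
  · by_cases htriv : ∀ σ : absoluteGaloisGroup K, θquot σ = 1
    · have hp3 : p = 3 := by
        rcases (show p = 3 ∨ p = 4 by omega) with h | h
        · exact h
        · exact absurd (Fact.out : p.Prime) (by rw [h]; decide)
      exact h3 W p hp3 hgood hred hanom hlat K hK hH hHp hodd hd3 htor ι v vbar hv hvbar hvne κ hκ γ N Dt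
        ι' hι' ΩK Ωp L hΩ hL θsub θquot hpair htriv Sf hSf θK hθK Cbar hC ΩK' Ωp' Lφ hΩ' hLφ
    · exact hne W p hp hgood hred hanom hlat K hK hH hHp hodd hd3 htor ι v vbar hv hvbar hvne κ hκ γ N Dt
        ι' hι' ΩK Ωp L hΩ hL θsub θquot hpair htriv Sf hSf θK hθK Cbar hC ΩK' Ωp' Lφ hΩ' hLφ

include stub_anacongOfFullDescentDatum in
/-- **[AN]-3-𝟙 DERIVED (sorry-free join)**: v20.3's `stub_anThreeTrivial` statement, token for token, from stubs 3a-A and 3a-B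
(idea-11 g9's `anThreeTrivial_of_pieces`: instantiate 3a-A at `2 < 3` with the datum of 3a-B; the binder `∀ σ, θquot σ = 1` is not
used). [cite: Kriz2016, Rem. 33 (first sentence)] [cite: CastellaGrossiLeeSkinner2022, Thm. 2.2.2 with (2.16)] -/
theorem anThreeTrivial_of_split :
    ∀ (W : WeierstrassCurve ℚ) [W.IsElliptic] [W.IsGloballyMinimal] (p : ℕ) [Fact p.Prime],
      p = 3 → Good W p → Red W p → Anom W p →
      (∀ Φ : AddSubgroup (geomTorsion W (p : ℤ)), IsRationalLine W p Φ → ¬ LineUnramifiedAt W p Φ) →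
      ∀ (K : Type) [Field K] [NumberField K], IsImaginaryQuadratic K →
        SatisfiesHeegnerHypothesis (W.conductorNorm ℤ) K → SatisfiesHeegnerHypothesis p K →
        Odd (NumberField.discr K) → NumberField.discr K ≠ -3 →
        (∀ Q : (W.baseChange K).toAffine.Point, p • Q = 0 → Q = 0) →
      ∀ (ι : K →+* ℚ_[p]) (v vbar : HeightOneSpectrum (𝓞 K)),
        (∀ x : 𝓞 K, x ∈ v.asIdeal ↔ ‖ι (x : K)‖ < 1) →
        ((p : ℕ) : 𝓞 K) ∈ vbar.asIdeal → vbar ≠ v →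
      ∀ (κ : ZpExtension K p), κ.IsAnticyclotomic →
      ∀ (γ : absoluteGaloisGroup K) [Fact (κ.IsTopGenerator γ)],
      ∀ (N : ℕ) [NeZero N] (Dt : ModularParametrizationData W N),
      ∀ (ι' : PadicAlgCl p ≃+* ℂ),
        (∀ (w : InfinitePlace K) (k : 𝓞 K), k ∈ v.asIdeal ↔ ‖ι'.symm (w.embedding (k : K))‖ < 1) →
      ∀ (ΩK : ℂ) (Ωp : (unrIntegers p)ˣ) (L : UnrSeries p), ΩK ≠ 0 →
        IsBDPLFunction ι' v κ γ Dt.f ΩK ((Ωp : unrIntegers p) : ℂ_[p]) L →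
      ∀ (θsub θquot : FramedGaloisRep K (padicCoeffIntegers (∅ : Set (PadicAlgCl p))) 1),
        IsResidualPairOver (W.baseChange K) p θsub θquot → (∀ σ : absoluteGaloisGroup K, θquot σ = 1) →
      ∀ (Sf : Finset (HeightOneSpectrum (𝓞 K))),
        (∀ w : HeightOneSpectrum (𝓞 K), w ∈ Sf ↔ ((W.conductorNorm ℤ : ℤ) : 𝓞 K) ∈ w.asIdeal) →
      ∀ (θK : HeckeCharacter K), IsHeckeCharOf ι' θquot θK →
      ∀ (Cbar : Finset (HeightOneSpectrum (𝓞 K))), (∀ u ∈ Cbar, ¬ θK.IsUnramifiedAt u) →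
      ∀ (ΩK' : ℂ) (Ωp' : (unrIntegers p)ˣ) (Lφ : UnrSeries p), ΩK' ≠ 0 →
        IsKatzLFunction ι' v vbar Cbar κ γ θK ΩK' ((Ωp' : unrIntegers p) : ℂ_[p]) Lφ →
      ∃ n nφ : ℕ, FirstUnitCoeffAt L n ∧ FirstUnitCoeffAt Lφ nφ ∧
        n + ∑ w ∈ Sf, curveLocalLambda κ (W.baseChange K) w =
          2 * nφ + ∑ w ∈ Sf, (charLocalLambda ∅ κ θsub w + charLocalLambda ∅ κ θquot w) := by
  intro W _ _ p _ hp hgood hred hanom hlat K _ _ hK hH hHp hodd hd3 htor ι v vbar hv hvbar hne κ hκ γ _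
      N _ Dt ι' hι' ΩK Ωp L hΩ hL θsub θquot hpair _ Sf hSf θK hθK Cbar hC ΩK' Ωp' Lφ hΩ' hLφ
  exact stub_anacongOfFullDescentDatum W p (by omega) hgood hred hanom (GoodLatticeBDPValueFullDescentStub.stub_fullDescentAtThreeOfRed W p hp hgood hred) hlat K
    hK hH hHp hodd hd3 htor ι v vbar hv hvbar hne κ hκ γ N Dt ι' hι' ΩK Ωp L hΩ hL θsub θquot hpair Sf hSf θK hθK Cbar hC ΩK'
    Ωp' Lφ hΩ' hLφ

include stub_publishedFacts stub_anacongOfFullDescentDatum stub_publishedFactsMore in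
/-- **[AN]-DS-Free IN THE ℚ-CURRENCY from the pieces**: [AN] in the CGLS currency (`thm222_OPEN_of_slices`,
read at the restricted pair via `isResidualPairOver_restrictField`) instantiated at the CGLS frame supplied by
AN-F₁ (stub 3b) and descended to `R₀` by AN-F₂ (stub 3c) at `m = ord(g(S=0) mod p)`; `n_φ` is replaced by
that index by the uniqueness of the first unit coefficient. [cite: KellerYin2024, Thms. 2.2.1–2.2.2]
[cite: CastellaGrossiLeeSkinner2022, Thm. 2.1.2, Thm. 2.2.2 with (2.13)–(2.16)] [cite: deShalit1987, II.6.4] -/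
theorem anQ_of_pieces :
    ∀ (W : WeierstrassCurve ℚ) [W.IsElliptic] [W.IsGloballyMinimal] (p : ℕ) [Fact p.Prime],
      2 < p → Good W p → Red W p → Anom W p →
      (∀ Φ : AddSubgroup (geomTorsion W (p : ℤ)), IsRationalLine W p Φ → ¬ LineUnramifiedAt W p Φ) →
      ∀ (K : Type) [Field K] [NumberField K], IsImaginaryQuadratic K →
        SatisfiesHeegnerHypothesis (W.conductorNorm ℤ) K → SatisfiesHeegnerHypothesis p K →
        Odd (NumberField.discr K) → NumberField.discr K ≠ -3 →
        (∀ Q : (W.baseChange K).toAffine.Point, p • Q = 0 → Q = 0) →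
      ∀ (ι : K →+* ℚ_[p]) (v vbar : HeightOneSpectrum (𝓞 K)),
        (∀ x : 𝓞 K, x ∈ v.asIdeal ↔ ‖ι (x : K)‖ < 1) →
        ((p : ℕ) : 𝓞 K) ∈ vbar.asIdeal → vbar ≠ v →
      ∀ (κ : ZpExtension K p), κ.IsAnticyclotomic →
      ∀ (γ : absoluteGaloisGroup K) [Fact (κ.IsTopGenerator γ)],
      ∀ (N : ℕ) [NeZero N] (Dt : ModularParametrizationData W N),
      ∀ (ι' : PadicAlgCl p ≃+* ℂ),
        (∀ (w : InfinitePlace K) (k : 𝓞 K), k ∈ v.asIdeal ↔ ‖ι'.symm (w.embedding (k : K))‖ < 1) →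
      ∀ (ΩK : ℂ) (Ωp : (unrIntegers p)ˣ) (L : UnrSeries p), ΩK ≠ 0 →
        IsBDPLFunction ι' v κ γ Dt.f ΩK ((Ωp : unrIntegers p) : ℂ_[p]) L →
      ∀ (Φ : AddSubgroup (geomTorsion W (p : ℤ))), IsRationalLine W p Φ →
      ∀ (θsub θquot : FramedGaloisRep ℚ (padicCoeffIntegers (∅ : Set (PadicAlgCl p))) 1),
        IsTeichmullerLiftOn (∅ : Set (PadicAlgCl p)) (Φ.map (geomTorsion W (p : ℤ)).subtype) θsub →
        IsTeichmullerLiftOnQuot (∅ : Set (PadicAlgCl p)) (Φ.map (geomTorsion W (p : ℤ)).subtype)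
          (geomTorsion W (p : ℤ)) θquot →
      ∀ (Sf : Finset (HeightOneSpectrum (𝓞 K))),
        (∀ w : HeightOneSpectrum (𝓞 K), w ∈ Sf ↔ ((W.conductorNorm ℤ : ℤ) : 𝓞 K) ∈ w.asIdeal) →
      ∀ (θK : HeckeCharacter K), IsHeckeCharOf ι' (θquot.restrictField K) θK →
      ∀ (S : Finset (HeightOneSpectrum (𝓞 K))),
        (∀ w : HeightOneSpectrum (𝓞 K), w ∈ S ↔ ¬ θK.IsUnramifiedAt w) →
      ∀ (κ' : ZpExtension K p) (γ' : absoluteGaloisGroup K), ZpExtension.IsTopGeneratorPair κ κ' γ γ' →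
      ∀ (Ω δ : ℂ) (Ωp' : (unrIntegers p)ˣ) (G : PowerSeries (PowerSeries (PadicComplexInt p)))
        (g : IwasawaAlgebra₂ p), Ω ≠ 0 →
        (δ ^ 2 = (NumberField.discr K : ℂ) ∨ δ ^ 2 = -(NumberField.discr K : ℂ)) →
        IsKatzMeasure₂ ι' v vbar S κ κ' γ⁻¹ γ'⁻¹ θK⁻¹ Ω δ ((Ωp' : unrIntegers p) : ℂ_[p]) G →
        (∀ (J : ℤ_[p] →+* PadicComplexInt p),
          (∀ x : ℤ_[p], ((J x : PadicComplexInt p) : ℂ_[p]) = ((x : ℚ_[p]) : ℂ_[p])) →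
          Associated (PowerSeries.map (PowerSeries.map J) g) G) →
        (g.map (PowerSeries.constantCoeff (R := ℤ_[p]))).map (IsLocalRing.residue ℤ_[p]) ≠ 0 →
      ∃ n : ℕ, FirstUnitCoeffAt L n ∧
        n + ∑ w ∈ Sf, curveLocalLambda κ (W.baseChange K) w =
          2 * ((g.map (PowerSeries.constantCoeff (R := ℤ_[p]))).map
                (IsLocalRing.residue ℤ_[p])).order.toNat +
            ∑ w ∈ Sf, (charLocalLambda ∅ κ (θsub.restrictField K) w +
              charLocalLambda ∅ κ (θquot.restrictField K) w) := by
  intro W _ _ p _ hp hgood hred hanom hGL K _ _ hK hHN hHp hodd hd3 hEK ι v vbar hv hvbar hne κ hκ γ _ N _ Dt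
    ι' hι' ΩK Ωp L hΩK hL Φ hΦ θsub θquot hsub hquot Sf hSf θK hθK S hS κ' γ' hpair' Ω δ Ωp' G g hΩ hδ hG
    hJ hg0
  obtain ⟨-, h5, hne', h212⟩ := stub_publishedFactsMore
  have hII64 : thmII64_katzMeasure₂_functionalEquation := stub_publishedFacts.2.2.2.2.2.1
  have han := thm222_OPEN_of_slices h5 hne' (anThreeTrivial_of_split stub_anacongOfFullDescentDatum)
  have hpairK := isResidualPairOver_restrictField W p K hΦ hsub hquot
  obtain ⟨ΩK', Ωp'', Q, hΩK', hΩp'', hQ, hm⟩ := GoodLatticeBDPValueAnQStubs.stub_katzLineIntFrameQ hII64 W p hp hgood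
    hred hanom hGL K
    hK hHN hHp hodd hd3 ι v vbar hv hvbar hne κ hκ γ ι' hι' Φ hΦ θsub θquot hsub hquot θK hθK S hS κ' γ'
    hpair' Ω δ Ωp' G g hΩ hδ hG hJ hg0
  obtain ⟨ΩK'', Ωp''', Lφ, hΩK'', hLφ, hdict⟩ := KatzLineDescent.stub_katzLineDescentQ h212 W p hp hgood hred
    hanom hGL K
    hK hHN hHp hodd hd3 ι v vbar hv hvbar hne κ hκ γ ι' hι' Φ hΦ θsub θquot hsub hquot θK hθK _
    ⟨ΩK', Ωp'', Q, hΩK', hΩp'', hQ, hm⟩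
  obtain ⟨n, nφ, hn, hnφ, hid⟩ := han W p hp hgood hred hanom hGL K hK hHN hHp hodd hd3 hEK ι v vbar hv
    hvbar hne κ hκ γ N Dt ι' hι' ΩK Ωp L hΩK hL (θsub.restrictField K) (θquot.restrictField K) hpairK Sf
    hSf θK hθK ∅ (by simp) ΩK'' Ωp''' Lφ hΩK'' hLφ
  obtain rfl := hnφ.unique hdict
  exact ⟨n, hn, hid⟩

include stub_publishedFacts stub_anacongOfFullDescentDatum stub_publishedFactsGreenberg stub_publishedFactsMore stub_publishedFactCD2 in
/-- **Composition**: the crux `GoodLatticeBDPValue` BY NAME from the registered stubs, by the landed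
assembled theorem `GoodLatticeBDPValueOfLambdaIdentityAnQ.goodLatticeBDPValue_of_pub_of_lambda_of_le_of_anQ`
(stub 1's seven PUB inputs feed `KellerYinHalves.thm308_of_cgls_of_muLambda` AND L-div; `GoodLatticeMuLambdaOnTree`
is DERIVED from [ALG-imp-λ] (stub 2a) + the KERNEL cotorsion clauses of KY Thm. 1.4.1 + [PWL-θ] (`≥`-half on stubs
4/4b.1, upgraded by the prop125 chain) + the `f`-side `≤` (the LANDED `FSideCorankLe.stub_fSideCorankLe`, p618030)
+ [AN]-DS-Free in the ℚ-currency ASSEMBLED IN THE KERNEL (`anQ_of_pieces`) from stub 3a (PRE, `p = 3`, `𝟙̃ = 𝟙`),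
stub 3b (AN-F₁, kernel), stub 3c (AN-F₂, kernel) and stub 4b's PUB slices). [cite: KellerYin2024, Thm. 3.0.8 (IMC2)] -/
theorem goodLatticeBDPValue_of_namedFacts :
    Summit.BirchSwinnertonDyer.BirchSwinnertonDyer.Theses.EisensteinPrimes.GoodLatticeBDPValue :=
  GoodLatticeBDPValueOfLambdaInequalityAnQ.goodLatticeBDPValue_of_pub_of_leTD_of_le_of_anQ
    stub_publishedFacts.1 stub_publishedFacts.2.1 stub_publishedFacts.2.2.1 stub_publishedFacts.2.2.2.1
    stub_publishedFacts.2.2.2.2.1 stub_publishedFacts.2.2.2.2.2.1 stub_publishedFacts.2.2.2.2.2.2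
    stub_publishedFactsGreenberg.1 stub_publishedFactsGreenberg.2.1 stub_publishedFactsGreenberg.2.2.1
    stub_publishedFactsGreenberg.2.2.2.1 stub_publishedFactsGreenberg.2.2.2.2.1
    stub_publishedFactsGreenberg.2.2.2.2.2.1 stub_publishedFactsGreenberg.2.2.2.2.2.2.1
    stub_publishedFactsGreenberg.2.2.2.2.2.2.2
    (Summit.BirchSwinnertonDyer.BirchSwinnertonDyer.Theorems.GoodLatticeBDPValueOfNamedFactsALG.imprimLambdaLE_of_index stub_publishedFactsGreenberg stub_publishedFactsMore stub_publishedFactCD2)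
    (prop125_imprimitive_of_quotient
      (prop125_quotient_of_corank (prop125_corank_of_ge
        (AcTwistDeformation.prop125_residualPair_unrSelmer_corank_ge_of_facts stub_publishedFactsMore.1
          stub_publishedFactsGreenberg.2.2.2.1 stub_publishedFactsGreenberg.2.2.2.2.1
          stub_publishedFactsGreenberg.2.2.1 stub_publishedFactsGreenberg.2.2.2.2.2.1))))
    FSideCorankLe.stub_fSideCorankLe
    (anQ_of_pieces stub_publishedFacts stub_anacongOfFullDescentDatum stub_publishedFactsMore)

end

end Summit.BirchSwinnertonDyer.BirchSwinnertonDyer.Theorems.GoodLatticeBDPValueOfNamedFacts
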